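import Literature.AlgebraicGeometry.Resolution.ArithmeticalThreefoldsLocalReductionOfParts
import Literature.AlgebraicGeometry.Resolution.ArithmeticalThreefoldsLocalRankReduction
import Literature.AlgebraicGeometry.Resolution.ArithmeticalThreefoldsLocalTameAscent
import HarnessLib

/-!
# Cossart–Piltant's reduction `(Thm. 1.5) ⇒ (LU for complete local domains)`: the rank-one input discharged

Topic: `Literature/AlgebraicGeometry/Resolution`. PROOF side of `CossartPiltant2019ReductionP`
(`ArithmeticalThreefoldsLocal.lean`). Of the three inputs (C3), (C4), (C5) left open by
`cossartPiltant2019ReductionP_of_principalization_of_parts`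
(`ArithmeticalThreefoldsLocalReductionOfParts.lean`), the reduction to rank-one valuations (C5)
("By [NSp] Theorem 1.1 or [CoP1] Proposition 5.1 it can be assumed that `v` has rank one",
Cossart–Piltant 2019, proof of Prop. 4.10) is now a theorem conditional on resolution of
excellent surfaces, `rankOne_reduction_of_cjs` (`ArithmeticalThreefoldsLocalRankReduction.lean`).
Hence:

* `cossartPiltant2019ReductionP_of_cjs_of_parts` — PROVED:
  `CossartPiltant2019Local → CossartPiltant2019Principalization → CossartJannsenSaito2020General →
  (C3) → (C4) → CossartPiltant2019ReductionP`, where (C3) is tame ascent along the prime-degree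
  Galois steps between the inertia and the ramification field ([CoP1] Prop. 6.3) and (C4) is
  descent below the ramification field ([CoP1] Prop. 9.3), both for rank-one valuations.

* `cossartPiltant2019ReductionP_of_cjs_of_descent` — PROVED: with (C3) also discharged
  (`tameAscent_of_descent`, `ArithmeticalThreefoldsLocalTameAscent.lean`, from (C4), cofinality
  and embedded resolution of surfaces):
  `CossartPiltant2019Local → CossartPiltant2019Principalization → CossartJannsenSaito2020General →
  (embedded resolution of surfaces, Cossart–Jannsen–Saito 2020 Cor. 1.5 = Cossart–Piltant 2019
  Prop. 4.3, as a hypothesis) → (C4) → CossartPiltant2019ReductionP`.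

Everything is PROVED; no named facts are introduced (the named facts and the embedded-resolution
statement enter as hypotheses).

## Sources

* V. Cossart, O. Piltant, J. Algebra 529 (2019) 268–535 = arXiv:1412.0868, Prop. 4.4 and proof of
  Prop. 4.10 (arXiv v1: Prop. 4.3, Prop. 4.8, pp. 53–54). [CossartPiltant2019]
* V. Cossart, O. Piltant, J. Algebra 320 (2008) 1051–1082: Prop. 6.3, Prop. 9.3 (HAL
  hal-00139124: Prop. 8.3, Prop. 9.5). [CossartPiltant2008]
* J. Novacoski, M. Spivakovsky, *Reduction of local uniformization to the rank one case* (2014),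
  Thm. 1.1. [NovacoskiSpivakovsky2014]
* V. Cossart, U. Jannsen, S. Saito, *Desingularization: invariants and strategy*, LNM 2270 (2020),
  Thm. 1.2 and Cor. 1.5. [CossartJannsenSaito2020]
-/

noncomputable section

open CategoryTheory AlgebraicGeometry TopologicalSpace IsLocalRing Polynomial IntermediateField Module

namespace Literature.AlgebraicGeometry.Resolution

universe u

/-- **Cossart–Piltant 2019, Prop. 4.10 from Thm. 1.5, principalization, resolution of excellent
surfaces and the two tame transfer results of [CoP1].** With the cofinality input discharged by
`CossartPiltant2019Principalization` and the rank-one reduction by `CossartJannsenSaito2020General`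
(`rankOne_reduction_of_cjs`), `CossartPiltant2019ReductionP` follows from the local theorem and
the inputs (C3) ([CoP1] Prop. 6.3: ascent along the prime-to-`p` Galois steps of `Fⁱ ⊆ ⋯ ⊆ Fʳ`)
and (C4) ([CoP1] Prop. 9.3: descent below the ramification field).
[cite: CossartPiltant2019, proof of Prop. 4.10 (arXiv v1: Prop. 4.8, pp. 53–54)]
[cite: CossartPiltant2008, Prop. 6.3 and Prop. 9.3 (HAL: Prop. 8.3, Prop. 9.5)]
[cite: NovacoskiSpivakovsky2014, Thm. 1.1] [cite: CossartJannsenSaito2020, Thm. 1.2] -/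
theorem cossartPiltant2019ReductionP_of_cjs_of_parts
    (hloc : CossartPiltant2019Local.{u}) (h44 : CossartPiltant2019Principalization.{u})
    (hCJS : CossartJannsenSaito2020General.{u})
    (hC3 :
      ∀ (p : ℕ), p.Prime →
      ∀ (S : Type u) [CommRing S] [IsDomain S] [IsRegularLocalRing S],
        IsExcellentRing S → ringKrullDim S = 3 → CharP (ResidueField S) p →
        IsAdicComplete (maximalIdeal S) S →
      ∀ (E : Type u) [Field E] [Algebra S E], Function.Injective (algebraMap S E) →
        IsAlgClosed E → Algebra.IsAlgebraic S E →
      ∀ (OE : ValuationSubring E), (∀ s : S, algebraMap S E s ∈ OE) →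
        (∀ s ∈ maximalIdeal S, OE.valuation (algebraMap S E s) < 1) →
        (∀ y : OE, ∃ q : S[X], (∃ i, q.coeff i ∉ maximalIdeal S) ∧
          OE.valuation (q.eval₂ (algebraMap S E) y) < 1) →
      Nonempty OE.valuation.RankOne →
      ∀ (M : Subfield E), (∀ s : S, algebraMap S E s ∈ M) →
      ∀ (N : IntermediateField M E) [FiniteDimensional M N] [IsGalois M N] (A B : Subfield E),
        (lift (fixedField (inertiaGroupIn OE N))).toSubfield ≤ A →
        B ≤ (lift (fixedField (ramificationGroupIn OE N))).toSubfield →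
        IsPrimeGaloisStep p A B →
        (∃ t : Finset E, (t : Set E) ⊆ A ∧
          A ≤ Subfield.closure (Set.range (algebraMap S E) ∪ (t : Set E)) ∧
          ∃ hTO : (Algebra.adjoin S (t : Set E)).toSubring ≤ OE.toSubring,
            IsRegularLocalRing (Localization.AtPrime
              (Ideal.comap (Subring.inclusion hTO) (maximalIdeal OE)))) →
        (∃ t : Finset E, (t : Set E) ⊆ B ∧
          B ≤ Subfield.closure (Set.range (algebraMap S E) ∪ (t : Set E)) ∧
          ∃ hTO : (Algebra.adjoin S (t : Set E)).toSubring ≤ OE.toSubring,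
            IsRegularLocalRing (Localization.AtPrime
              (Ideal.comap (Subring.inclusion hTO) (maximalIdeal OE)))))
    (hC4 :
      ∀ (p : ℕ), p.Prime →
      ∀ (S : Type u) [CommRing S] [IsDomain S] [IsRegularLocalRing S],
        IsExcellentRing S → ringKrullDim S = 3 → CharP (ResidueField S) p →
        IsAdicComplete (maximalIdeal S) S →
      ∀ (E : Type u) [Field E] [Algebra S E], Function.Injective (algebraMap S E) →
        IsAlgClosed E → Algebra.IsAlgebraic S E →
      ∀ (OE : ValuationSubring E), (∀ s : S, algebraMap S E s ∈ OE) →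
        (∀ s ∈ maximalIdeal S, OE.valuation (algebraMap S E s) < 1) →
        (∀ y : OE, ∃ q : S[X], (∃ i, q.coeff i ∉ maximalIdeal S) ∧
          OE.valuation (q.eval₂ (algebraMap S E) y) < 1) →
      Nonempty OE.valuation.RankOne →
      ∀ (M : Subfield E), (∀ s : S, algebraMap S E s ∈ M) →
      ∀ (N : IntermediateField M E) [FiniteDimensional M N] [IsGalois M N] (K' : Subfield E),
        M ≤ K' → K' ≤ (lift (fixedField (ramificationGroupIn OE N))).toSubfield →
        (∃ t : Finset E, (t : Set E) ⊆ K' ∧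
          K' ≤ Subfield.closure (Set.range (algebraMap S E) ∪ (t : Set E)) ∧
          ∃ hTO : (Algebra.adjoin S (t : Set E)).toSubring ≤ OE.toSubring,
            IsRegularLocalRing (Localization.AtPrime
              (Ideal.comap (Subring.inclusion hTO) (maximalIdeal OE)))) →
        (∃ t : Finset E, (t : Set E) ⊆ M ∧
          M ≤ Subfield.closure (Set.range (algebraMap S E) ∪ (t : Set E)) ∧
          ∃ hTO : (Algebra.adjoin S (t : Set E)).toSubring ≤ OE.toSubring,
            IsRegularLocalRing (Localization.AtPrime
              (Ideal.comap (Subring.inclusion hTO) (maximalIdeal OE))))) :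
    CossartPiltant2019ReductionP.{u} :=
  cossartPiltant2019ReductionP_of_principalization_of_parts hloc h44 hC3 hC4
    (fun p hp S _ _ _ hS hSdim hSchar hScomp E _ _ hinj hE halg =>
      rankOne_reduction_of_cjs hCJS p hp S hS hSdim hSchar hScomp E hinj hE halg)


/-- **Cossart–Piltant 2019, Prop. 4.10 from Thm. 1.5, principalization, resolution of excellent
surfaces (embedded and non-embedded) and tame descent.** With (C5) discharged by
`CossartJannsenSaito2020General` (`rankOne_reduction_of_cjs`) and (C3) by `tameAscent_of_descent`,
`CossartPiltant2019ReductionP` follows from the local theorem, principalization, embedded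
resolution of closed subschemes of dimension `≤ 2` of regular excellent schemes (the hypothesis
`hEmb`: Cossart–Jannsen–Saito 2020, Cor. 1.5, as used by Cossart–Piltant 2019, Prop. 4.3) and the
one remaining transfer input (C4) ([CoP1] Prop. 9.3: descent below the ramification field, for
rank-one valuations).
[cite: CossartPiltant2019, Props. 4.3, 4.4 and proof of Prop. 4.10 (arXiv v1: Props. 4.2, 4.3, 4.8, pp. 50–54)]
[cite: CossartPiltant2008, Prop. 9.3 (HAL: Prop. 9.5)] [cite: CossartJannsenSaito2020, Thm. 1.2, Cor. 1.5] -/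
theorem cossartPiltant2019ReductionP_of_cjs_of_descent
    (hloc : CossartPiltant2019Local.{u}) (h44 : CossartPiltant2019Principalization.{u})
    (hCJS : CossartJannsenSaito2020General.{u})
    (hEmb : ∀ (Z : Scheme.{u}) [IsIntegral Z] [IsNoetherian Z], Scheme.IsRegular Z →
      Scheme.IsExcellent Z → ∀ (X : Set Z), IsClosed X → X ≠ Set.univ → topologicalKrullDim X ≤ 2 →
        ∃ (Z' : Scheme.{u}) (π : Z' ⟶ Z), IsProper π ∧ Function.Surjective π.base ∧
          (∃ U : Z.Opens, (U : Set Z) = Xᶜ ∧ IsIso (π ∣_ U)) ∧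
          IsStrictNormalCrossingsDivisor Z' (π.base ⁻¹' X))
    (hC4 :
      ∀ (p : ℕ), p.Prime →
      ∀ (S : Type u) [CommRing S] [IsDomain S] [IsRegularLocalRing S],
        IsExcellentRing S → ringKrullDim S = 3 → CharP (ResidueField S) p →
        IsAdicComplete (maximalIdeal S) S →
      ∀ (E : Type u) [Field E] [Algebra S E], Function.Injective (algebraMap S E) →
        IsAlgClosed E → Algebra.IsAlgebraic S E →
      ∀ (OE : ValuationSubring E), (∀ s : S, algebraMap S E s ∈ OE) →
        (∀ s ∈ maximalIdeal S, OE.valuation (algebraMap S E s) < 1) →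
        (∀ y : OE, ∃ q : S[X], (∃ i, q.coeff i ∉ maximalIdeal S) ∧
          OE.valuation (q.eval₂ (algebraMap S E) y) < 1) →
      Nonempty OE.valuation.RankOne →
      ∀ (M : Subfield E), (∀ s : S, algebraMap S E s ∈ M) →
      ∀ (N : IntermediateField M E) [FiniteDimensional M N] [IsGalois M N] (K' : Subfield E),
        M ≤ K' → K' ≤ (lift (fixedField (ramificationGroupIn OE N))).toSubfield →
        (∃ t : Finset E, (t : Set E) ⊆ K' ∧
          K' ≤ Subfield.closure (Set.range (algebraMap S E) ∪ (t : Set E)) ∧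
          ∃ hTO : (Algebra.adjoin S (t : Set E)).toSubring ≤ OE.toSubring,
            IsRegularLocalRing (Localization.AtPrime
              (Ideal.comap (Subring.inclusion hTO) (maximalIdeal OE)))) →
        (∃ t : Finset E, (t : Set E) ⊆ M ∧
          M ≤ Subfield.closure (Set.range (algebraMap S E) ∪ (t : Set E)) ∧
          ∃ hTO : (Algebra.adjoin S (t : Set E)).toSubring ≤ OE.toSubring,
            IsRegularLocalRing (Localization.AtPrime
              (Ideal.comap (Subring.inclusion hTO) (maximalIdeal OE))))) :
    CossartPiltant2019ReductionP.{u} :=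
  cossartPiltant2019ReductionP_of_principalization_of_descent hloc h44 hEmb hC4
    (fun p hp S _ _ _ hS hSdim hSchar hScomp E _ _ hinj hE halg =>
      rankOne_reduction_of_cjs hCJS p hp S hS hSdim hSchar hScomp E hinj hE halg)

end Literature.AlgebraicGeometry.Resolution

end
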